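import Mathlib
import HarnessLib
import Summits.HubbardSuperconductivity.HubbardSuperconductivity.Theorems.KLProgrammeKLRegimeSplitTwoLegSizesMSChainCurves
import Summits.HubbardSuperconductivity.HubbardSuperconductivity.Theorems.KLProgrammeKLRegimeSplitTwoLegReadingSlopes

/-!
# Route `KLProgramme`, crux K3 — gen-5 ENGINE child (stmt-…-19918, `stub_twoLeg_step`, clause `TwoLegSizesMST`), recipe (L)+(F):
# ONE CHAIN STEP — the curve-tower DIFFERENCES of two consecutive chain frames ((P4-c), step 4c)

Seat hubbard-kl-k3c3-p1 (g3).  Two consecutive frames of the telescoped chain, `msChain d Kp n N (k−1)` and `msChain d Kp n N k`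
(`1 ≤ k ≤ N − n`), differ by ONE high part `highPart d (Kp (n+k))` (`eval_msChain_succ`).  Given any sizes `e j` of that high part
(`‖Dʲ evalM (highPart …)‖ ≤ e j`, `j ≤ 4` — the caller chooses contraction `4·anchorSize` or a Jackson gain, `…PieceParts`) and the chain
regime of `chain_curve_sizes` (budget `A ≥ chainSizeSum … j`, `j ≤ 2`, `A ≤ 1/20`, `klCurveD ≤ Dt_min − 2A`, level margins, `A₃, A₄`),
k3c3-p3's two-frame implicit-function tower (P2-INTERFACE §§2–3: `abs_frameRadius_sub_le`, `abs_deriv_frameRadius_sub_le`,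
`abs_deriv_tower_frameRadius_sub_le`, `norm_iteratedFDeriv_fermiPointLp_sub_le_four_orders`, radius towers `frameRadius_tower_of_sizes`)
gives the radius differences `msW0 … msW4` (the P2 right-hand sides with `E₀ = e 0`, `E_j = 2ʲ e j`, `R = klCurveR1, klCurveR2, klCurveT3 A₃,
klCurveT4 A₃ A₄`, written out as definitions) and the curve differences `msdD`: `‖γ_k θ − γ_{k−1} θ‖ ≤ msdD 0 = msW0` and
`‖γ_k⁽ⁱ⁾ θ − γ_{k−1}⁽ⁱ⁾ θ‖ ≤ msdD i` (`1 ≤ i ≤ 4`, binomial sums of the `W`), in the `iteratedDeriv` key of `comp_sub_centred_sizes`.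
Definitions are explicit polynomial bookkeeping only; proofs only; nothing about the model.
-/

noncomputable section

namespace Summit.HubbardSuperconductivity.HubbardSuperconductivity.Theorems.KLRegimeSplit

set_option linter.dupNamespace false -- summit = problem name (single-conjunct summit), D-0017
set_option maxSynthPendingDepth 4 -- nested operator-norm instances (up to fourth Fréchet derivatives and their sums), as in `…CompDiff`

open Real Finset Literature.MathematicalPhysics.QuantumLattice Literature.MathematicalPhysics.QuantumLattice.BandSectorCounting
open Summit.HubbardSuperconductivity.HubbardSuperconductivity.Theorems.DispersionFlow
open Summit.HubbardSuperconductivity.HubbardSuperconductivity.Theorems.PerturbedFermiCurve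

/-! ## §1 The step constants (P2-INTERFACE §2 right-hand sides, written out) -/

/-- Order-0 radius difference `W₀ = E₀/(Dt − 2A)`. -/
def msW0 (A Dt : ℝ) (e : ℕ → ℝ) : ℝ := e 0 / (Dt - 2 * A)

/-- Order-1 radius difference `W₁` (`abs_deriv_frameRadius_sub_le` with `E₁ = 2e₁`). -/
def msW1 (A Dt : ℝ) (e : ℕ → ℝ) : ℝ :=
    ((4 + 2 * A) * (e 0 / (Dt - 2 * A)) +
    (π * Real.sqrt 2 + (4 + 2 * A) * (π * Real.sqrt 2) / (Dt - 2 * A)) * ((4 + 4 * A) * (e 0 / (Dt - 2 * A)) + (2 * e 1))) /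
    (Dt - 2 * A)

/-- Order-2 radius difference `W₂` (first conjunct of `abs_deriv_tower_frameRadius_sub_le`, `E₂ = 4e₂`, `R₁ = klCurveR1`, `R₂ = klCurveR2`). -/
def msW2 (A A₃ Dt : ℝ) (e : ℕ → ℝ) : ℝ :=
    e 0 / (Dt - 2 * A) +
    (((4 + 8 * A₃) * (e 0 / (Dt - 2 * A)) + (4 * e 2)) * (klCurveR1 + π * Real.sqrt 2) ^ 2 +
    2 * (4 + 4 * A) * (klCurveR1 + π * Real.sqrt 2) * (msW1 A Dt e + e 0 / (Dt - 2 * A)) +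
    ((4 + 4 * A) * (e 0 / (Dt - 2 * A)) + (2 * e 1)) * (2 * klCurveR1 + π * Real.sqrt 2) +
    (4 + 2 * A) * (e 0 / (Dt - 2 * A) + 2 * msW1 A Dt e) +
    (klCurveR2 + π * Real.sqrt 2) * ((4 + 4 * A) * (e 0 / (Dt - 2 * A)) + (2 * e 1))) / (Dt - 2 * A)

/-- Order-3 radius difference `W₃` (second conjunct, `E₃ = 8e₃`, `R₃ = klCurveT3 A₃`). -/
def msW3 (A A₃ A₄ Dt : ℝ) (e : ℕ → ℝ) : ℝ :=
    (((4 + 16 * A₄) * (e 0 / (Dt - 2 * A)) + (8 * e 3)) * (klCurveR1 + π * Real.sqrt 2) ^ 3 +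
    3 * (4 + 8 * A₃) * (msW1 A Dt e + e 0 / (Dt - 2 * A)) * (klCurveR1 + π * Real.sqrt 2) ^ 2 +
    3 * (((4 + 8 * A₃) * (e 0 / (Dt - 2 * A)) + (4 * e 2)) * (klCurveR1 + π * Real.sqrt 2) * (klCurveR2 + 2 * klCurveR1 + π * Real.sqrt 2) +
    (4 + 4 * A) * ((msW2 A A₃ Dt e + 2 * msW1 A Dt e + e 0 / (Dt - 2 * A)) * (klCurveR1 + π * Real.sqrt 2) +
    (klCurveR2 + 2 * klCurveR1 + π * Real.sqrt 2) * (msW1 A Dt e + e 0 / (Dt - 2 * A)))) +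
    ((4 + 4 * A) * (e 0 / (Dt - 2 * A)) + (2 * e 1)) * (3 * klCurveR2 + 3 * klCurveR1 + π * Real.sqrt 2) +
    (4 + 2 * A) * (3 * msW2 A A₃ Dt e + 3 * msW1 A Dt e + e 0 / (Dt - 2 * A)) +
    klCurveT3 A₃ * ((4 + 4 * A) * (e 0 / (Dt - 2 * A)) + (2 * e 1))) / (Dt - 2 * A)

/-- Order-4 radius difference `W₄` (third conjunct, `E₄ = 16e₄`, `R₄ = klCurveT4 A₃ A₄`; carries the non-Lipschitz term `2·(16A₄)·(R₁+π√2)⁴`). -/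
def msW4 (A A₃ A₄ Dt : ℝ) (e : ℕ → ℝ) : ℝ :=
    ((4 * (e 0 / (Dt - 2 * A)) + 2 * (16 * A₄) + (16 * e 4)) * (klCurveR1 + π * Real.sqrt 2) ^ 4 +
    4 * (4 + 16 * A₄) * (msW1 A Dt e + e 0 / (Dt - 2 * A)) * (klCurveR1 + π * Real.sqrt 2) ^ 3 +
    6 * ((((4 + 16 * A₄) * (e 0 / (Dt - 2 * A)) + (8 * e 3)) * (klCurveR1 + π * Real.sqrt 2) ^ 2 * (klCurveR2 + 2 * klCurveR1 + π * Real.sqrt 2) +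
    (4 + 8 * A₃) * ((msW2 A A₃ Dt e + 2 * msW1 A Dt e + e 0 / (Dt - 2 * A)) * (klCurveR1 + π * Real.sqrt 2) ^ 2 +
    2 * (klCurveR1 + π * Real.sqrt 2) * (klCurveR2 + 2 * klCurveR1 + π * Real.sqrt 2) * (msW1 A Dt e + e 0 / (Dt - 2 * A))))) +
    3 * ((((4 + 8 * A₃) * (e 0 / (Dt - 2 * A)) + (4 * e 2)) * (klCurveR2 + 2 * klCurveR1 + π * Real.sqrt 2) ^ 2 +
    2 * (4 + 4 * A) * (klCurveR2 + 2 * klCurveR1 + π * Real.sqrt 2) * (msW2 A A₃ Dt e + 2 * msW1 A Dt e + e 0 / (Dt - 2 * A)))) +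
    4 * ((((4 + 8 * A₃) * (e 0 / (Dt - 2 * A)) + (4 * e 2)) * (klCurveR1 + π * Real.sqrt 2) * (klCurveT3 A₃ + 3 * klCurveR1 + 3 * klCurveR2 + π * Real.sqrt 2) +
    (4 + 4 * A) * ((msW1 A Dt e + e 0 / (Dt - 2 * A)) * (klCurveT3 A₃ + 3 * klCurveR1 + 3 * klCurveR2 + π * Real.sqrt 2) +
    (klCurveR1 + π * Real.sqrt 2) * (msW3 A A₃ A₄ Dt e + 3 * msW1 A Dt e + 3 * msW2 A A₃ Dt e + e 0 / (Dt - 2 * A))))) +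
    ((4 + 4 * A) * (e 0 / (Dt - 2 * A)) + (2 * e 1)) * (6 * klCurveR2 + 4 * klCurveT3 A₃ + 4 * klCurveR1 + π * Real.sqrt 2) +
    (4 + 2 * A) * (6 * msW2 A A₃ Dt e + 4 * msW3 A A₃ A₄ Dt e + 4 * msW1 A Dt e + e 0 / (Dt - 2 * A)) +
    klCurveT4 A₃ A₄ * ((4 + 4 * A) * (e 0 / (Dt - 2 * A)) + (2 * e 1))) / (Dt - 2 * A)

/-- **The curve-tower differences of one chain step**: `msdD 0 = W₀` (distance of the two Fermi points) and the binomial sums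
`2(W₀+W₁), 2(W₀+2W₁+W₂), 2(W₀+3W₁+3W₂+W₃), 2(W₀+4W₁+6W₂+4W₃+W₄)` (P2-INTERFACE §3). -/
def msdD (A A₃ A₄ Dt : ℝ) (e : ℕ → ℝ) : ℕ → ℝ
  | 0 => msW0 A Dt e
  | 1 => 2 * (msW0 A Dt e + msW1 A Dt e)
  | 2 => 2 * (msW0 A Dt e + 2 * msW1 A Dt e + msW2 A A₃ Dt e)
  | 3 => 2 * (msW0 A Dt e + 3 * msW1 A Dt e + 3 * msW2 A A₃ Dt e + msW3 A A₃ A₄ Dt e)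
  | _ => 2 * (msW0 A Dt e + 4 * msW1 A Dt e + 6 * msW2 A A₃ Dt e + 4 * msW3 A A₃ A₄ Dt e + msW4 A A₃ A₄ Dt e)

/-! ## §2 Nested Fréchet derivatives are additive (smooth summands) -/

section Nested

variable {E : Type*} [NormedAddCommGroup E] [NormedSpace ℝ E] {f g : E → ℝ} (hf : ContDiff ℝ 5 f) (hg : ContDiff ℝ 5 g)
include hf hg

/-- Nested Fréchet derivatives of orders `1 … 4` of a sum of `C⁵` functions split. [folklore] -/
theorem nested_fderiv_add :
    (fderiv ℝ (fun x => f x + g x) = fun x => fderiv ℝ f x + fderiv ℝ g x) ∧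
    (fderiv ℝ (fderiv ℝ (fun x => f x + g x)) = fun x => fderiv ℝ (fderiv ℝ f) x + fderiv ℝ (fderiv ℝ g) x) ∧
    (fderiv ℝ (fderiv ℝ (fderiv ℝ (fun x => f x + g x))) =
      fun x => fderiv ℝ (fderiv ℝ (fderiv ℝ f)) x + fderiv ℝ (fderiv ℝ (fderiv ℝ g)) x) ∧
    (fderiv ℝ (fderiv ℝ (fderiv ℝ (fderiv ℝ (fun x => f x + g x)))) =
      fun x => fderiv ℝ (fderiv ℝ (fderiv ℝ (fderiv ℝ f))) x + fderiv ℝ (fderiv ℝ (fderiv ℝ (fderiv ℝ g))) x) := by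
  have f1 : ContDiff ℝ 4 (fderiv ℝ f) := hf.fderiv_right (m := 4) (by norm_num)
  have g1 : ContDiff ℝ 4 (fderiv ℝ g) := hg.fderiv_right (m := 4) (by norm_num)
  have f2 : ContDiff ℝ 3 (fderiv ℝ (fderiv ℝ f)) := f1.fderiv_right (m := 3) (by norm_num)
  have g2 : ContDiff ℝ 3 (fderiv ℝ (fderiv ℝ g)) := g1.fderiv_right (m := 3) (by norm_num)
  have f3 : ContDiff ℝ 2 (fderiv ℝ (fderiv ℝ (fderiv ℝ f))) := f2.fderiv_right (m := 2) (by norm_num)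
  have g3 : ContDiff ℝ 2 (fderiv ℝ (fderiv ℝ (fderiv ℝ g))) := g2.fderiv_right (m := 2) (by norm_num)
  have e1 : fderiv ℝ (fun x => f x + g x) = fun x => fderiv ℝ f x + fderiv ℝ g x :=
    funext fun x => fderiv_fun_add ((hf.differentiable (by norm_num)) x) ((hg.differentiable (by norm_num)) x)
  have e2 : fderiv ℝ (fderiv ℝ (fun x => f x + g x)) = fun x => fderiv ℝ (fderiv ℝ f) x + fderiv ℝ (fderiv ℝ g) x := by
    rw [e1]; exact funext fun x => fderiv_fun_add ((f1.differentiable (by norm_num)) x) ((g1.differentiable (by norm_num)) x)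
  have e3 : fderiv ℝ (fderiv ℝ (fderiv ℝ (fun x => f x + g x))) =
      fun x => fderiv ℝ (fderiv ℝ (fderiv ℝ f)) x + fderiv ℝ (fderiv ℝ (fderiv ℝ g)) x := by
    rw [e2]; exact funext fun x => fderiv_fun_add ((f2.differentiable (by norm_num)) x) ((g2.differentiable (by norm_num)) x)
  have e4 : fderiv ℝ (fderiv ℝ (fderiv ℝ (fderiv ℝ (fun x => f x + g x)))) =
      fun x => fderiv ℝ (fderiv ℝ (fderiv ℝ (fderiv ℝ f))) x + fderiv ℝ (fderiv ℝ (fderiv ℝ (fderiv ℝ g))) x := by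
    rw [e3]; exact funext fun x => fderiv_fun_add ((f3.differentiable (by norm_num)) x) ((g3.differentiable (by norm_num)) x)
  exact ⟨e1, e2, e3, e4⟩

end Nested

/-! ## §3 One chain step -/

section Step

variable (d : ℕ) {Kp : ℕ → TrigPolyC4v} {n N : ℕ} (hnN : n ≤ N) {a : ℕ → ℕ → ℝ}
  (ha : ∀ m ≤ N, ∀ j ≤ 4, ∀ q : Momentum, ‖iteratedFDeriv ℝ j (evalM (Kp m)) q‖ ≤ a m j)

/-- The distance of the Fermi points of two frames on one ray is the radius difference. -/
theorem norm_toLp_klFermiPoint_sub (μ : ℝ) (K K' : TrigPolyC4v) (θ : ℝ) :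
    ‖(WithLp.toLp 2 (klFermiPoint μ K' θ) : Momentum) - WithLp.toLp 2 (klFermiPoint μ K θ)‖ =
      |perturbedFermiRadius (fun p : Fin 2 → ℝ => -K'.eval p) μ θ - perturbedFermiRadius (fun p : Fin 2 → ℝ => -K.eval p) μ θ| := by
  rw [klFermiPoint, klFermiPoint, ← WithLp.toLp_sub, ← sub_smul, WithLp.toLp_smul, norm_smul, norm_toLp_dir, mul_one,
    Real.norm_eq_abs]

include hnN ha in
/-- **ONE CHAIN STEP (P2-INTERFACE §§2–3 instantiated).**  See the module docstring. -/
theorem chain_step_curve_diff {A : ℝ} (hA : ∀ j ≤ 2, chainSizeSum Kp a n N j ≤ A) (hA20 : A ≤ 1 / 20)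
    (hd : klCurveD ≤ (bandBounds (show (-4 : ℝ) < -1.1 by norm_num) (show (-1.1 : ℝ) ≤ -0.1 by norm_num)
      (show (-0.1 : ℝ) < 0 by norm_num)).Dtmin - 2 * A)
    {μ : ℝ} (hlo : (-1.1 : ℝ) ≤ μ - A) (hhi : μ + A ≤ -0.1)
    {A₃ A₄ : ℝ} (hA₃ : chainSizeSum Kp a n N 3 ≤ A₃) (hA₄ : chainSizeSum Kp a n N 4 ≤ A₄) {k : ℕ} (hk1 : 1 ≤ k) (hk : k ≤ N - n)
    {e : ℕ → ℝ} (he : ∀ j ≤ 4, ∀ q : Momentum, ‖iteratedFDeriv ℝ j (evalM (highPart d (Kp (n + k)))) q‖ ≤ e j) (θ : ℝ) :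
    ‖(WithLp.toLp 2 (klFermiPoint μ (msChain d Kp n N k) θ) : Momentum) - WithLp.toLp 2 (klFermiPoint μ (msChain d Kp n N (k - 1)) θ)‖ ≤
      msdD A A₃ A₄ ((bandBounds (show (-4 : ℝ) < -1.1 by norm_num) (show (-1.1 : ℝ) ≤ -0.1 by norm_num)
        (show (-0.1 : ℝ) < 0 by norm_num)).Dtmin) e 0 ∧
    ∀ i, 1 ≤ i → i ≤ 4 →
      ‖iteratedDeriv i (fun θ : ℝ => (WithLp.toLp 2 (klFermiPoint μ (msChain d Kp n N k) θ) : Momentum)) θ -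
          iteratedDeriv i (fun θ : ℝ => (WithLp.toLp 2 (klFermiPoint μ (msChain d Kp n N (k - 1)) θ) : Momentum)) θ‖ ≤
        msdD A A₃ A₄ ((bandBounds (show (-4 : ℝ) < -1.1 by norm_num) (show (-1.1 : ℝ) ≤ -0.1 by norm_num)
          (show (-0.1 : ℝ) < 0 by norm_num)).Dtmin) e i := by
  set B := bandBounds (show (-4 : ℝ) < -1.1 by norm_num) (show (-1.1 : ℝ) ≤ -0.1 by norm_num) (show (-0.1 : ℝ) < 0 by norm_num)
    with hBdef
  set K := msChain d Kp n N (k - 1) with hKdef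
  set K' := msChain d Kp n N k with hK'def
  set P := highPart d (Kp (n + k)) with hPdef
  have hADt : 2 * A < B.Dtmin := by have := klCurveD_pos; linarith
  have hk' : k - 1 ≤ N - n := by omega
  -- frame sizes of both chain frames
  have hAK : ∀ p : Momentum, ∀ j ≤ 2, ‖iteratedFDeriv ℝ j (frameShift K) p‖ ≤ A := fun p j hj =>
    (norm_iteratedFDeriv_frameShift_msChain_le_sum d hnN ha hk' (by omega) p).trans (hA j hj)
  have hAK' : ∀ p : Momentum, ∀ j ≤ 2, ‖iteratedFDeriv ℝ j (frameShift K') p‖ ≤ A := fun p j hj =>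
    (norm_iteratedFDeriv_frameShift_msChain_le_sum d hnN ha hk (by omega) p).trans (hA j hj)
  have h3K : ∀ p : Momentum, ‖iteratedFDeriv ℝ 3 (frameShift K) p‖ ≤ A₃ := fun p =>
    (norm_iteratedFDeriv_frameShift_msChain_le_sum d hnN ha hk' (by norm_num) p).trans hA₃
  have h4K : ∀ p : Momentum, ‖iteratedFDeriv ℝ 4 (frameShift K) p‖ ≤ A₄ := fun p =>
    (norm_iteratedFDeriv_frameShift_msChain_le_sum d hnN ha hk' (by norm_num) p).trans hA₄
  have h3K' : ∀ p : Momentum, ‖iteratedFDeriv ℝ 3 (frameShift K') p‖ ≤ A₃ := fun p =>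
    (norm_iteratedFDeriv_frameShift_msChain_le_sum d hnN ha hk (by norm_num) p).trans hA₃
  have h4K' : ∀ p : Momentum, ‖iteratedFDeriv ℝ 4 (frameShift K') p‖ ≤ A₄ := fun p =>
    (norm_iteratedFDeriv_frameShift_msChain_le_sum d hnN ha hk (by norm_num) p).trans hA₄
  -- the step: `K' = K ⊕ P` on values
  have hstep : (fun p : Fin 2 → ℝ => -K'.eval p) = fun p => (-K.eval p) + (-P.eval p) := by
    funext p
    rw [hK'def, hKdef, hPdef, show k = (k - 1) + 1 by omega, eval_msChain_succ, show n + (k - 1) + 1 = n + (k - 1 + 1) by omega]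
    simp only [Nat.add_sub_cancel]; ring
  have hcK : ContDiff ℝ 5 (fun p : Fin 2 → ℝ => -K.eval p) := by
    rw [← frameShift_toLp_eq_neg_eval]; exact (contDiff_frameShift K).comp (PiLp.contDiff_toLp (p := 2))
  have hcP : ContDiff ℝ 5 (fun p : Fin 2 → ℝ => -P.eval p) := by
    rw [← frameShift_toLp_eq_neg_eval]; exact (contDiff_frameShift P).comp (PiLp.contDiff_toLp (p := 2))
  obtain ⟨n1, n2, n3, n4⟩ := nested_fderiv_add hcK hcP
  -- sizes of the high part, transported to `Fin 2 → ℝ`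
  have heP : ∀ j ≤ 4, ∀ kk : Fin 2 → ℝ, ‖iteratedFDeriv ℝ j (fun p : Fin 2 → ℝ => -P.eval p) kk‖ ≤ e j * 2 ^ j := by
    intro j hj kk
    rw [← frameShift_toLp_eq_neg_eval]
    exact norm_iteratedFDeriv_frameShift_toLp_le_single (fun q => by rw [norm_iteratedFDeriv_frameShift_eq]; exact he j hj q) kk
  have hE₀ : ∀ kk : Fin 2 → ℝ, (∀ i, |kk i| ≤ π) →
      |(fun p : Fin 2 → ℝ => -K'.eval p) kk - (fun p : Fin 2 → ℝ => -K.eval p) kk| ≤ e 0 := by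
    intro kk _
    have h := heP 0 (by norm_num) kk
    rw [norm_iteratedFDeriv_zero, Real.norm_eq_abs, pow_zero, mul_one] at h
    rw [hstep]; simpa using h
  have hE₁ : ∀ kk : Fin 2 → ℝ, (∀ i, |kk i| ≤ π) →
      ‖fderiv ℝ (fun p : Fin 2 → ℝ => -K'.eval p) kk - fderiv ℝ (fun p : Fin 2 → ℝ => -K.eval p) kk‖ ≤ 2 * e 1 := by
    intro kk _
    have h := heP 1 (by norm_num) kk
    rw [← norm_fderiv_eq_norm_iteratedFDeriv_one] at h
    rw [hstep, n1]; dsimp only; rw [add_sub_cancel_left]; linarith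
  have hE₂ : ∀ kk : Fin 2 → ℝ, (∀ i, |kk i| ≤ π) →
      ‖fderiv ℝ (fderiv ℝ (fun p : Fin 2 → ℝ => -K'.eval p)) kk - fderiv ℝ (fderiv ℝ (fun p : Fin 2 → ℝ => -K.eval p)) kk‖ ≤
        4 * e 2 := by
    intro kk _
    have h := heP 2 (by norm_num) kk
    rw [← norm_fderiv_two_eq_norm_iteratedFDeriv] at h
    rw [hstep, n2]; dsimp only; rw [add_sub_cancel_left]; linarith
  have hE₃ : ∀ kk : Fin 2 → ℝ, (∀ i, |kk i| ≤ π) →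
      ‖fderiv ℝ (fderiv ℝ (fderiv ℝ (fun p : Fin 2 → ℝ => -K'.eval p))) kk -
        fderiv ℝ (fderiv ℝ (fderiv ℝ (fun p : Fin 2 → ℝ => -K.eval p))) kk‖ ≤ 8 * e 3 := by
    intro kk _
    have h := heP 3 (by norm_num) kk
    rw [← norm_fderiv_three_eq_norm_iteratedFDeriv] at h
    rw [hstep, n3]; dsimp only; rw [add_sub_cancel_left]; linarith
  have hE₄ : ∀ kk : Fin 2 → ℝ, (∀ i, |kk i| ≤ π) →
      ‖fderiv ℝ (fderiv ℝ (fderiv ℝ (fderiv ℝ (fun p : Fin 2 → ℝ => -K'.eval p)))) kk -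
        fderiv ℝ (fderiv ℝ (fderiv ℝ (fderiv ℝ (fun p : Fin 2 → ℝ => -K.eval p)))) kk‖ ≤ 16 * e 4 := by
    intro kk _
    have h := heP 4 (by norm_num) kk
    rw [← norm_fderiv_four_eq_norm_iteratedFDeriv] at h
    rw [hstep, n4]; dsimp only; rw [add_sub_cancel_left]; linarith
  -- radius towers of both frames
  obtain ⟨-, r1, r2, r3, r4⟩ := frameRadius_tower_of_sizes hAK hA20 hd hlo hhi h3K h4K θ
  obtain ⟨-, r1', r2', r3', -⟩ := frameRadius_tower_of_sizes hAK' hA20 hd hlo hhi h3K' h4K' θ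
  -- the radius differences
  have hW₀ := abs_frameRadius_sub_le B hAK hAK' hADt hlo hhi hE₀ θ
  have hW₁ : |deriv (perturbedFermiRadius (fun p : Fin 2 → ℝ => -K'.eval p) μ) θ -
      deriv (perturbedFermiRadius (fun p : Fin 2 → ℝ => -K.eval p) μ) θ| ≤ msW1 A B.Dtmin e := by
    unfold msW1; exact abs_deriv_frameRadius_sub_le B hAK hAK' hADt hlo hhi hE₀ hE₁ θ
  have hW₂ : |deriv (deriv (perturbedFermiRadius (fun p : Fin 2 → ℝ => -K'.eval p) μ)) θ -
      deriv (deriv (perturbedFermiRadius (fun p : Fin 2 → ℝ => -K.eval p) μ)) θ| ≤ msW2 A A₃ B.Dtmin e := by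
    unfold msW2
    exact (abs_deriv_tower_frameRadius_sub_le B hAK hAK' hADt hlo hhi hE₀ h3K h4K hE₁ hE₂ hE₃ hE₄ r1 r1' r2 r2' r3 r3' r4 hW₁
      le_rfl le_rfl).1
  have hW₃ : |deriv (deriv (deriv (perturbedFermiRadius (fun p : Fin 2 → ℝ => -K'.eval p) μ))) θ -
      deriv (deriv (deriv (perturbedFermiRadius (fun p : Fin 2 → ℝ => -K.eval p) μ))) θ| ≤ msW3 A A₃ A₄ B.Dtmin e := by
    unfold msW3
    exact (abs_deriv_tower_frameRadius_sub_le B hAK hAK' hADt hlo hhi hE₀ h3K h4K hE₁ hE₂ hE₃ hE₄ r1 r1' r2 r2' r3 r3' r4 hW₁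
      hW₂ le_rfl).2.1
  have hW₄ : |deriv (deriv (deriv (deriv (perturbedFermiRadius (fun p : Fin 2 → ℝ => -K'.eval p) μ)))) θ -
      deriv (deriv (deriv (deriv (perturbedFermiRadius (fun p : Fin 2 → ℝ => -K.eval p) μ)))) θ| ≤ msW4 A A₃ A₄ B.Dtmin e := by
    unfold msW4
    exact (abs_deriv_tower_frameRadius_sub_le B hAK hAK' hADt hlo hhi hE₀ h3K h4K hE₁ hE₂ hE₃ hE₄ r1 r1' r2 r2' r3 r3' r4 hW₁
      hW₂ hW₃).2.2
  -- the curve differences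
  obtain ⟨c1, c2, c3, c4⟩ := norm_iteratedFDeriv_fermiPointLp_sub_le_four_orders B hAK hAK' hADt hlo hhi hW₀ hW₁ hW₂ hW₃ hW₄
  -- `iteratedDeriv` key
  have hC : ContDiff ℝ 4 (fun θ : ℝ => (WithLp.toLp 2 (klFermiPoint μ K θ) : Momentum)) :=
    (chain_curve_sizes d hnN ha hA hA20 hd hlo hhi hA₃ hA₄ hk' θ).1
  have hC' : ContDiff ℝ 4 (fun θ : ℝ => (WithLp.toLp 2 (klFermiPoint μ K' θ) : Momentum)) :=
    (chain_curve_sizes d hnN ha hA hA20 hd hlo hhi hA₃ hA₄ hk θ).1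
  have key : ∀ i ≤ 4,
      ‖iteratedDeriv i (fun θ : ℝ => (WithLp.toLp 2 (klFermiPoint μ K' θ) : Momentum)) θ -
          iteratedDeriv i (fun θ : ℝ => (WithLp.toLp 2 (klFermiPoint μ K θ) : Momentum)) θ‖ =
        ‖iteratedFDeriv ℝ i (fun θ : ℝ => (WithLp.toLp 2 (klFermiPoint μ K' θ) : Momentum)) θ -
          iteratedFDeriv ℝ i (fun θ : ℝ => (WithLp.toLp 2 (klFermiPoint μ K θ) : Momentum)) θ‖ := by
    intro i hi
    have h1 : ContDiffAt ℝ i (fun θ : ℝ => (WithLp.toLp 2 (klFermiPoint μ K' θ) : Momentum)) θ :=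
      (hC'.of_le (by exact_mod_cast hi)).contDiffAt
    have h2 : ContDiffAt ℝ i (fun θ : ℝ => (WithLp.toLp 2 (klFermiPoint μ K θ) : Momentum)) θ :=
      (hC.of_le (by exact_mod_cast hi)).contDiffAt
    rw [← iteratedDeriv_sub h1 h2, ← iteratedFDeriv_sub_apply h1 h2, norm_iteratedFDeriv_eq_norm_iteratedDeriv]
  refine ⟨?_, ?_⟩
  · rw [norm_toLp_klFermiPoint_sub]; simpa [msdD, msW0] using hW₀
  · intro i hi1 hi4
    rw [key i hi4]
    interval_cases i
    · simpa [msdD, msW0] using c1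
    · simpa [msdD, msW0] using c2
    · simpa [msdD, msW0] using c3
    · simpa [msdD, msW0] using c4

end Step

end Summit.HubbardSuperconductivity.HubbardSuperconductivity.Theorems.KLRegimeSplit

end
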